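import Summits.ValiantsHypothesis.ValiantsHypothesis.Theorems.DualUnipotentThreeHalves.Negative.ThinWildFalse
import Summits.ValiantsHypothesis.ValiantsHypothesis.Theorems.GrenetZeonTwoDimCoefficientsDualUnipotentUnfoldCore
import Summits.ValiantsHypothesis.ValiantsHypothesis.Theorems.DualUnipotentThreeHalves.Negative.FlagCheapIndexBound

/-!
# `¬ ThinWildBlockForm`: the knapsack statement T3 of the dead line `thin_wild` is false

Negative lane of crux `GrenetZeon.DualUnipotentThreeHalves` (item `stmt-ValiantsHypothesis-24318`; desk #251(c) /
#262: T3 box).  This file closes nothing and proves nothing about the `3/2` rung, `per_n` or VP ≠ VNP.  It records,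
kernel-checked, that statement **T3 `ThinWildBlockForm`** of the (dead) line `thin_wild`
(`Cruxes/DualUnipotentThreeHalves/Lines/thin_wild.lean`, tree sha16 `257da148ab0aab37`) is FALSE as stated — so the
line's sorry-free composition `dualUnipotentThreeHalves_of_blockForm : ThinWildBlockForm → DualUnipotentThreeHalves`
cannot be fed: after `¬ ThinWild` / `¬ ThinWildFat` (`ThinWildFalse.lean`) this was the last open box of that line.

T3 asks, for EVERY homogeneous-linear nilpotent pencil `N : ℂ^{n×n} → M_m(ℂ)` with `m ≤ q³`, a constant change of basis
`P·N·Q` (`P·Q = 1`) that is block-upper-triangular for some level function, with diagonal constituents of nil-index data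
`r`, and with charge `q²·levelCharge(g,S,r) + wildRank ≤ C·q·(m+q)`.  The pencil ONTO an irreducible space kills it:

* `exists_linear_pencil_onto` — for any subspace `L' ⊆ M_d(ℂ)` with `dim L' ≤ n²` a pencil `N` with homogeneous linear
  entries whose values `N(x)` are exactly the members of `L'`, together with the coefficient identity
  `Σ_c v_c·coeff_{x_c}((P N Q)_{ij}) = (P·N(v)·Q)_{ij}` (tops = values for a linear pencil);
* `thinWildBlockForm_false : ¬ (body of ThinWildBlockForm)` — the body is T3 with the skeleton-local definitions
  `IsBlockUpper`, `levelCharge`, `wildRank ∘ wildMap ∘ linCoeff` unfolded in place (`diagBlock` is the landed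
  `DimTwoCases.diagBlock`); it is DEFINITIONALLY the skeleton's `ThinWildBlockForm`
  (`example : ¬ ThinWildBlockForm := thinWildBlockForm_false` checked in scratch against verbatim copies of the
  skeleton's definitions, since `Cruxes/…/Lines/*.lean` is not importable here).  Witness against `C`: the pencil onto the
  `Fin 3k` copy of `L′_k` (`exists_Lfin`: irreducible, all `M^{2k+1} = 0`, some `M₀^{2k} ≠ 0`, `dim ≥ k²`) with
  `q = 2C+4`, `k = (3C+1)·q`, `m = n = 3k ≤ q³`.  By the bridge lemma `level_const_of_irreducible` a conjugate block form
  of an irreducible space has ONE level `ℓ`; its diagonal block is the whole pencil, so `r ℓ ≥ 2k+1` (evaluate at `M₀`);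
  if `ℓ ∈ S` then `levelCharge ≥ r ℓ − 1 ≥ 2k` and `q²·2k > C·q·(3k+q)`; if `ℓ ∉ S` then `wildRank = dim (P·L′·Q) ≥ k²
  > C·q·(3k+q)` (the wild map is `v ↦ vec(P·N(v)·Q)`, which contains the injective image of `L′`).

So the per-agnostic knapsack T3 fails for the same reason T2 did: irreducible spaces of nilpotent matrices can have large
dimension AND large nil-index simultaneously (`L′_k`), and a single conjugation cannot grade them.  Classification:
negative lemma on a skeleton-local stub of a line already marked dead (`Lines/thin_wild_dead.md`); `--supports
stmt-ValiantsHypothesis-24318`; no Theses declaration is asserted or negated; definition-free.  Mathlib + landed Negative /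
UnfoldCore / FlagCheapIndexBound files only. [folklore; statement of this development]
-/

set_option linter.dupNamespace false
set_option autoImplicit false

namespace Summit.ValiantsHypothesis.ValiantsHypothesis.Theorems.DualUnipotentThreeHalvesNegative.ThinWild

open Matrix MvPolynomial
open Summit.ValiantsHypothesis.ValiantsHypothesis.Cruxes.TwoDimCoefficients.DimTwoCases (diagBlock)
open Summit.ValiantsHypothesis.ValiantsHypothesis.Theorems.DualUnipotentThreeHalvesNegative.FlagCost (coeff_conj_apply)

/-! ## A linear pencil onto a given matrix space -/

/-- Evaluating a constant-conjugated polynomial matrix. -/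
theorem map_eval_conj {d : ℕ} {σ : Type*} (P Q : Matrix (Fin d) (Fin d) ℂ)
    (N : Matrix (Fin d) (Fin d) (MvPolynomial σ ℂ)) (x : σ → ℂ) :
    (P.map C * N * Q.map C : Matrix (Fin d) (Fin d) (MvPolynomial σ ℂ)).map (eval x) =
      P * N.map (eval x) * Q := by
  have h : ((eval x : MvPolynomial σ ℂ → ℂ) ∘ (C : ℂ → MvPolynomial σ ℂ)) = id := funext fun a => eval_C a
  rw [Matrix.map_mul, Matrix.map_mul, Matrix.map_map, Matrix.map_map, h, Matrix.map_id, Matrix.map_id]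

/-- Bilinearity of `(v, F) ↦ P (∑ v_c F_c) Q`, entrywise. -/
theorem sum_mul_conj_apply {d : ℕ} {σ : Type*} [Fintype σ] (P Q : Matrix (Fin d) (Fin d) ℂ)
    (F : σ → Matrix (Fin d) (Fin d) ℂ) (v : σ → ℂ) (i j : Fin d) :
    ∑ c, v c * (P * F c * Q) i j = (P * (∑ c, v c • F c) * Q) i j := by
  rw [Finset.mul_sum, Finset.sum_mul, Matrix.sum_apply]
  refine Finset.sum_congr rfl fun c _ => ?_
  rw [Matrix.mul_smul, Matrix.smul_mul, Matrix.smul_apply, smul_eq_mul]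

/-- **Linear pencils onto a matrix space.**  Every subspace `L' ⊆ M_d(ℂ)` with `dim L' ≤ n²` is the image of a pencil
`N` over the `n × n` variables with HOMOGENEOUS LINEAR entries: `N(x) ∈ L'` for all `x`, every member of `L'` is some
`N(x)`, the top (linear part) of `N` along `v` is `N(v)`, and linear coefficients commute with constant conjugation. -/
theorem exists_linear_pencil_onto (d n : ℕ) (L' : Submodule ℂ (Matrix (Fin d) (Fin d) ℂ))
    (hD : Module.finrank ℂ L' ≤ n * n) :
    ∃ N : Matrix (Fin d) (Fin d) (MvPolynomial (Fin n × Fin n) ℂ),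
      (∀ i j, (N i j).IsHomogeneous 1) ∧
      (∀ x : Fin n × Fin n → ℂ, N.map (eval x) ∈ L') ∧
      (∀ M ∈ L', ∃ x : Fin n × Fin n → ℂ, N.map (eval x) = M) ∧
      (∀ (P Q : Matrix (Fin d) (Fin d) ℂ) (v : Fin n × Fin n → ℂ) (i j : Fin d),
        ∑ c, v c * coeff (Finsupp.single c 1) ((P.map C * N * Q.map C :
          Matrix (Fin d) (Fin d) (MvPolynomial (Fin n × Fin n) ℂ)) i j) = (P * N.map (eval v) * Q) i j) := by
  classical
  set D := Module.finrank ℂ L' with hDdef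
  let b := Module.finBasis ℂ L'
  let B : Fin D → Matrix (Fin d) (Fin d) ℂ := fun s => ((b s : L') : Matrix (Fin d) (Fin d) ℂ)
  let emb : Fin D → Fin n × Fin n := fun s => finProdFinEquiv.symm (Fin.castLE hD s)
  have hemb : Function.Injective emb := fun s s' h =>
    Fin.castLE_injective hD (finProdFinEquiv.symm.injective h)
  let N : Matrix (Fin d) (Fin d) (MvPolynomial (Fin n × Fin n) ℂ) :=
    Matrix.of fun i j => ∑ s, C (B s i j) * MvPolynomial.X (emb s)
  have hN : ∀ i j, N i j = ∑ s, C (B s i j) * MvPolynomial.X (emb s) := fun i j => rfl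
  -- values
  have heval : ∀ x : Fin n × Fin n → ℂ, N.map (eval x) = ∑ s, x (emb s) • B s := by
    intro x
    ext i j
    simp only [Matrix.map_apply, hN, map_sum, map_mul, eval_C, eval_X, Matrix.sum_apply, Matrix.smul_apply,
      smul_eq_mul]
    exact Finset.sum_congr rfl fun s _ => mul_comm _ _
  -- tops
  have htop : ∀ (v : Fin n × Fin n → ℂ) (i j : Fin d),
      ∑ c, v c * coeff (Finsupp.single c 1) (N i j) = (N.map (eval v)) i j := by
    intro v i j
    rw [heval]
    simp only [hN, coeff_sum, coeff_C_mul, coeff_X, Matrix.sum_apply, Matrix.smul_apply, smul_eq_mul,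
      Finsupp.single_left_inj one_ne_zero, mul_ite, mul_one, mul_zero, Finset.mul_sum]
    rw [Finset.sum_comm]
    refine Finset.sum_congr rfl fun s _ => ?_
    rw [Finset.sum_ite_eq Finset.univ (emb s) (fun c => v c * B s i j), if_pos (Finset.mem_univ _)]
  refine ⟨N, ?_, ?_, ?_, ?_⟩
  · intro i j
    rw [hN]
    refine IsHomogeneous.sum _ _ _ fun s _ => ?_
    simpa using (isHomogeneous_C _ (B s i j)).mul (isHomogeneous_X ℂ (emb s) : (MvPolynomial.X (emb s) :
      MvPolynomial (Fin n × Fin n) ℂ).IsHomogeneous 1)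
  · intro x
    rw [heval]
    exact Submodule.sum_mem _ fun s _ => Submodule.smul_mem _ _ (b s).2
  · intro M hM
    refine ⟨Function.extend emb (fun s => b.repr ⟨M, hM⟩ s) 0, ?_⟩
    rw [heval]
    simp only [hemb.extend_apply]
    have h := b.sum_repr ⟨M, hM⟩
    have h' : ((∑ i, b.repr ⟨M, hM⟩ i • b i : L') : Matrix (Fin d) (Fin d) ℂ) = M := by rw [h]
    rw [Submodule.coe_sum] at h'
    simpa only [Submodule.coe_smul] using h'
  · intro P Q v i j
    simp only [coeff_conj_apply]
    rw [sum_mul_conj_apply]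
    have hsum : (∑ c, v c • N.map (coeff (Finsupp.single c 1))) = N.map (eval v) := by
      refine Matrix.ext fun i' j' => ?_
      simp only [Matrix.sum_apply, Matrix.smul_apply, Matrix.map_apply, smul_eq_mul]
      exact htop v i' j'
    rw [hsum]

/-- Additivity of the inlined wild-parameter map (the `map_add'` field of the skeleton's `wildMap`, restated for
the unfolded `toFun`). -/
theorem wild_add {n m : ℕ} (M' : Matrix (Fin m) (Fin m) (MvPolynomial (Fin n × Fin n) ℂ)) (lev : Fin m → ℕ)
    (S : Finset ℕ) (v w : Fin n × Fin n → ℂ) :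
    (fun ij : Fin m × Fin m => if lev ij.1 = lev ij.2 ∧ lev ij.1 ∉ S then
        ∑ c, (v + w) c * coeff (Finsupp.single c 1) (M' ij.1 ij.2) else 0) =
      (fun ij : Fin m × Fin m => if lev ij.1 = lev ij.2 ∧ lev ij.1 ∉ S then
        ∑ c, v c * coeff (Finsupp.single c 1) (M' ij.1 ij.2) else 0) +
      (fun ij : Fin m × Fin m => if lev ij.1 = lev ij.2 ∧ lev ij.1 ∉ S then
        ∑ c, w c * coeff (Finsupp.single c 1) (M' ij.1 ij.2) else 0) := by
  funext ij
  simp only [Pi.add_apply]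
  split_ifs
  · simp only [add_mul, Finset.sum_add_distrib]
  · simp

/-- Homogeneity of the inlined wild-parameter map (the `map_smul'` field). -/
theorem wild_smul {n m : ℕ} (M' : Matrix (Fin m) (Fin m) (MvPolynomial (Fin n × Fin n) ℂ)) (lev : Fin m → ℕ)
    (S : Finset ℕ) (a : ℂ) (v : Fin n × Fin n → ℂ) :
    (fun ij : Fin m × Fin m => if lev ij.1 = lev ij.2 ∧ lev ij.1 ∉ S then
        ∑ c, (a • v) c * coeff (Finsupp.single c 1) (M' ij.1 ij.2) else 0) =
      (RingHom.id ℂ) a • (fun ij : Fin m × Fin m => if lev ij.1 = lev ij.2 ∧ lev ij.1 ∉ S then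
        ∑ c, v c * coeff (Finsupp.single c 1) (M' ij.1 ij.2) else 0) := by
  funext ij
  simp only [Pi.smul_apply, smul_eq_mul, RingHom.id_apply]
  split_ifs
  · simp only [mul_assoc, Finset.mul_sum]
  · simp

/-! ## The negative theorem -/

/-- **`¬ ThinWildBlockForm`.**  The body is statement T3 of the line `thin_wild` (skeleton
`Cruxes/DualUnipotentThreeHalves/Lines/thin_wild.lean`, tree sha16 `257da148ab0aab37`) with the skeleton-local
definitions `IsBlockUpper`, `levelCharge`, `wildRank`/`wildMap`/`linCoeff` unfolded in place (`diagBlock` is the landed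
`DimTwoCases.diagBlock`); the displayed `Prop` is definitionally the skeleton's `ThinWildBlockForm` (checked by `Iff.rfl`
against verbatim copies of those definitions in scratch).  Witness against `C`: the linear pencil onto (a `Fin 3k` copy of)
`L′_k`, `q = 2C + 4`, `k = (3C+1)·q`, `m = n = 3k ≤ q³`; by the bridge lemma every conjugate block form has ONE level `ℓ`,
whose diagonal block is the whole pencil, so `r ℓ ≥ 2k + 1`; if `ℓ ∈ S` the level charge is `≥ 2k` and
`q²·2k > C·q·(m+q)`, if `ℓ ∉ S` the wild rank is `dim L′_k ≥ k² > C·q·(m+q)`. -/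
theorem thinWildBlockForm_false : ¬ (∃ C : ℕ, ∀ (n m q : ℕ)
    (N : Matrix (Fin m) (Fin m) (MvPolynomial (Fin n × Fin n) ℂ)), 1 ≤ q → m ≤ q ^ 3 →
    (∀ i j, (N i j).IsHomogeneous 1) → N ^ m = 0 →
    ∃ (P Q : Matrix (Fin m) (Fin m) ℂ) (lev : Fin m → ℕ) (g : ℕ) (S : Finset ℕ) (r : ℕ → ℕ),
      P * Q = 1 ∧
      (∀ i j : Fin m, lev j < lev i →
        (P.map MvPolynomial.C * N * Q.map MvPolynomial.C : Matrix (Fin m) (Fin m) (MvPolynomial (Fin n × Fin n) ℂ))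
          i j = 0) ∧
      (∀ u : Fin m, lev u < g) ∧
      (∀ l : ℕ, diagBlock (P.map MvPolynomial.C * N * Q.map MvPolynomial.C) lev l ^ r l = 0) ∧
      q ^ 2 * (g + ∑ l ∈ S, (r l - 1)) +
        Module.finrank ℂ (LinearMap.range
          ({ toFun := fun v : Fin n × Fin n → ℂ => fun ij : Fin m × Fin m =>
                if lev ij.1 = lev ij.2 ∧ lev ij.1 ∉ S then
                  ∑ c, v c * coeff (Finsupp.single c 1)
                    ((P.map MvPolynomial.C * N * Q.map MvPolynomial.C :
                      Matrix (Fin m) (Fin m) (MvPolynomial (Fin n × Fin n) ℂ)) ij.1 ij.2)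
                else 0
             map_add' := wild_add (P.map MvPolynomial.C * N * Q.map MvPolynomial.C) lev S
             map_smul' := wild_smul (P.map MvPolynomial.C * N * Q.map MvPolynomial.C) lev S } :
            (Fin n × Fin n → ℂ) →ₗ[ℂ] (Fin m × Fin m → ℂ))) ≤ C * q * (m + q)) := by
  classical
  rintro ⟨C, hC⟩
  -- the witness parameters
  set q : ℕ := 2 * C + 4 with hq
  set k : ℕ := (3 * C + 1) * q with hk
  have hq1 : 1 ≤ q := by omega
  have hk1 : 1 ≤ k := by rw [hk]; exact Nat.le_mul_of_pos_right _ (by omega) |>.trans' (by omega)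
  obtain ⟨L', -, hirr, ⟨M₀, hM₀, hM₀pow⟩, hnil, hdim⟩ := exists_Lfin k hk1
  -- the pencil onto `L′`
  have hD : Module.finrank ℂ L' ≤ (3 * k) * (3 * k) := by
    have := Submodule.finrank_le L'
    simpa [Module.finrank_matrix] using this
  obtain ⟨N, hhom, hval, hsurj, hlin⟩ := exists_linear_pencil_onto (3 * k) (3 * k) L' hD
  -- `N ^ (3k) = 0` as a polynomial matrix
  have hNpow : N ^ (3 * k) = 0 := by
    refine Matrix.ext fun i j => ?_
    apply MvPolynomial.funext
    intro x
    have h1 : ((N ^ (3 * k)).map (eval x)) i j = 0 := by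
      rw [Matrix.map_pow N (eval x : MvPolynomial (Fin (3 * k) × Fin (3 * k)) ℂ →+* ℂ)]
      have h2 : (N.map (eval x)) ^ (2 * k + 1) = 0 := hnil _ (hval x)
      rw [pow_eq_zero_of_le (by omega) h2, Matrix.zero_apply]
    simpa using h1
  have hm : 3 * k ≤ q ^ 3 := by
    rw [hk, pow_succ, sq]
    have : 3 * (3 * C + 1) ≤ q * q := by rw [hq]; nlinarith
    calc 3 * ((3 * C + 1) * q) = 3 * (3 * C + 1) * q := by ring
      _ ≤ q * q * q := Nat.mul_le_mul_right q this
  obtain ⟨P, Q, lev, g, S, r, hPQ, hup, -, hdiag, hcharge⟩ := hC (3 * k) (3 * k) q N hq1 hm hhom hNpow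
  set M' : Matrix (Fin (3 * k)) (Fin (3 * k)) (MvPolynomial (Fin (3 * k) × Fin (3 * k)) ℂ) :=
    P.map MvPolynomial.C * N * Q.map MvPolynomial.C with hM'
  -- one level
  have hupC : ∀ M ∈ L', ∀ i j, lev j < lev i → (P * M * Q) i j = 0 := by
    intro M hM i j hij
    obtain ⟨x, rfl⟩ := hsurj M hM
    have h := congrArg (eval x) (hup i j hij)
    rw [← map_eval_conj P Q N x, Matrix.map_apply]
    simpa using h
  have hconst := level_const_of_irreducible L' hirr P Q hPQ lev hupC
  let u₀ : Fin (3 * k) := ⟨0, by omega⟩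
  -- the single diagonal block is everything, so `r (lev u₀) ≥ 2k + 1`
  have hblk : diagBlock M' lev (lev u₀) = M' := by
    ext i j
    simp [diagBlock, hconst i u₀, hconst j u₀]
  have hpowM' : M' ^ r (lev u₀) = 0 := by rw [← hblk]; exact hdiag (lev u₀)
  obtain ⟨x₀, hx₀⟩ := hsurj M₀ hM₀
  have hQP : Q * P = 1 := mul_eq_one_comm.mp hPQ
  have hM₀r : M₀ ^ r (lev u₀) = 0 := by
    have h1 : (M' ^ r (lev u₀)).map (eval x₀) = 0 := by
      rw [hpowM', Matrix.map_zero _ (map_zero _)]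
    rw [Matrix.map_pow M' (eval x₀ : MvPolynomial _ ℂ →+* ℂ), hM', map_eval_conj, hx₀, conj_pow P M₀ Q hPQ] at h1
    calc M₀ ^ r (lev u₀) = (Q * P) * M₀ ^ r (lev u₀) * (Q * P) := by rw [hQP, Matrix.one_mul, Matrix.mul_one]
      _ = Q * (P * M₀ ^ r (lev u₀) * Q) * P := by simp only [Matrix.mul_assoc]
      _ = 0 := by rw [h1, Matrix.mul_zero, Matrix.zero_mul]
  have hr : 2 * k + 1 ≤ r (lev u₀) := by
    by_contra hlt
    apply hM₀pow
    rw [show 2 * k = r (lev u₀) + (2 * k - r (lev u₀)) by omega, pow_add, hM₀r, Matrix.zero_mul]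
  -- the charge
  by_cases hS : lev u₀ ∈ S
  · have hsum : r (lev u₀) - 1 ≤ ∑ l ∈ S, (r l - 1) :=
      Finset.single_le_sum (f := fun l => r l - 1) (fun _ _ => Nat.zero_le _) hS
    have h1 : q ^ 2 * (2 * k) ≤ C * q * (3 * k + q) := by
      calc q ^ 2 * (2 * k) ≤ q ^ 2 * (g + ∑ l ∈ S, (r l - 1)) := Nat.mul_le_mul_left _ (by omega)
        _ ≤ C * q * (3 * k + q) := le_trans (Nat.le_add_right _ _) hcharge
    have h2 : q ^ 2 * (q * (6 * C + 2)) ≤ q ^ 2 * (C * (9 * C + 4)) := by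
      have e1 : q ^ 2 * (2 * k) = q ^ 2 * (q * (6 * C + 2)) := by rw [hk]; ring
      have e2 : C * q * (3 * k + q) = q ^ 2 * (C * (9 * C + 4)) := by rw [hk]; ring
      rw [← e1, ← e2]; exact h1
    have h3 := Nat.le_of_mul_le_mul_left h2 (by positivity)
    rw [hq] at h3
    nlinarith
  · -- wild rank ≥ dim L′ ≥ k²
    have hcond : ∀ ij : Fin (3 * k) × Fin (3 * k), lev ij.1 = lev ij.2 ∧ lev ij.1 ∉ S := fun ij =>
      ⟨(hconst ij.1 u₀).trans (hconst ij.2 u₀).symm, (hconst ij.1 u₀).symm ▸ hS⟩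
    -- the injective vectorised conjugation `φ M = vec (P M Q)`
    let φ : Matrix (Fin (3 * k)) (Fin (3 * k)) ℂ →ₗ[ℂ] (Fin (3 * k) × Fin (3 * k) → ℂ) :=
      IsLinearMap.mk' (fun M ij => (P * M * Q) ij.1 ij.2)
        ⟨fun M M₁ => by funext ij; simp [Matrix.mul_add, Matrix.add_mul],
         fun a M => by funext ij; simp⟩
    have hφ : ∀ M ij, φ M ij = (P * M * Q) ij.1 ij.2 := fun _ _ => rfl
    have hφinj : Function.Injective φ := by
      intro M M₁ h
      have h' : P * M * Q = P * M₁ * Q := by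
        ext i j; exact congrFun h (i, j)
      calc M = (Q * P) * M * (Q * P) := by rw [hQP, Matrix.one_mul, Matrix.mul_one]
        _ = Q * (P * M * Q) * P := by simp only [Matrix.mul_assoc]
        _ = Q * (P * M₁ * Q) * P := by rw [h']
        _ = (Q * P) * M₁ * (Q * P) := by simp only [Matrix.mul_assoc]
        _ = M₁ := by rw [hQP, Matrix.one_mul, Matrix.mul_one]
    have hle : L'.map φ ≤ LinearMap.range
        ({ toFun := fun v : Fin (3 * k) × Fin (3 * k) → ℂ => fun ij : Fin (3 * k) × Fin (3 * k) =>
              if lev ij.1 = lev ij.2 ∧ lev ij.1 ∉ S then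
                ∑ c, v c * coeff (Finsupp.single c 1) (M' ij.1 ij.2) else 0
           map_add' := wild_add M' lev S
           map_smul' := wild_smul M' lev S } :
          (Fin (3 * k) × Fin (3 * k) → ℂ) →ₗ[ℂ] (Fin (3 * k) × Fin (3 * k) → ℂ)) := by
      rintro _ ⟨M, hM, rfl⟩
      obtain ⟨x, hx⟩ := hsurj M hM
      refine ⟨x, ?_⟩
      funext ij
      simp only [LinearMap.coe_mk, AddHom.coe_mk, if_pos (hcond ij), hφ]
      rw [hM', hlin P Q x ij.1 ij.2, hx]
    have hfin := Submodule.finrank_mono hle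
    have hmap : Module.finrank ℂ (L'.map φ) = Module.finrank ℂ L' :=
      (LinearEquiv.finrank_eq (Submodule.equivMapOfInjective φ hφinj L')).symm
    have h1 : k ^ 2 ≤ C * q * (3 * k + q) := by
      calc k ^ 2 ≤ Module.finrank ℂ L' := hdim
        _ = Module.finrank ℂ (L'.map φ) := hmap.symm
        _ ≤ _ := hfin
        _ ≤ C * q * (3 * k + q) := le_trans (Nat.le_add_left _ _) hcharge
    have h2 : q ^ 2 * ((3 * C + 1) * (3 * C + 1)) ≤ q ^ 2 * (C * (9 * C + 4)) := by
      have e1 : k ^ 2 = q ^ 2 * ((3 * C + 1) * (3 * C + 1)) := by rw [hk]; ring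
      have e2 : C * q * (3 * k + q) = q ^ 2 * (C * (9 * C + 4)) := by rw [hk]; ring
      rw [← e1, ← e2]; exact h1
    have h3 := Nat.le_of_mul_le_mul_left h2 (by positivity)
    nlinarith

end Summit.ValiantsHypothesis.ValiantsHypothesis.Theorems.DualUnipotentThreeHalvesNegative.ThinWild
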